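import Mathlib.AlgebraicGeometry.EllipticCurve.Reduction
import Mathlib.NumberTheory.Padics.PadicIntegers
import Literature.NumberTheory.EllipticCurves.GlobalMinimalModel
import Literature.NumberTheory.EllipticCurves.Tamagawa
import HarnessLib

/-!
# Named fact: every elliptic curve over `ℚ` has a good ordinary prime `p ≥ 5`

Grounder file (D-0014 named facts) for the route `BirchSwinnertonDyer/PAdicOrder`, statement item
stmt-BirchSwinnertonDyer-0140 (`pAdicOrder_existsOrdinary`).

For an elliptic curve `E/ℚ` the set of primes of good *ordinary* reduction is infinite (indeed of
density `1` if `E` has no CM, by Serre's Chebotarev-density theorem — supersingular primes have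
density `0`, Serre 1981 §8 — and of density `1/2` if `E` has CM, the ordinary primes being those
split in the CM field, Deuring 1941); in particular there is such a prime `p ≥ 5`. For `p ≥ 5` of
good reduction, "ordinary" is `p ∤ a_p` (equivalently `a_p ≠ 0` by the Hasse bound), with
`a_p = p + 1 − #Ẽ(𝔽_p)` computed on a globally minimal model (`WeierstrassCurve.frobeniusTrace`).

Nothing is asserted; users take `(h : WeierstrassCurve.exists_good_ordinary_prime)`.

## References

* J.-P. Serre, *Quelques applications du théorème de densité de Chebotarev*, Publ. Math. IHÉS 54
  (1981), 123–201, §8 (density of supersingular primes for non-CM curves is `0`).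
* M. Deuring, *Die Typen der Multiplikatorenringe elliptischer Funktionenkörper*, Abh. Math. Sem.
  Hamburg 14 (1941) (CM case: ordinary = split primes).
* J. H. Silverman, *The Arithmetic of Elliptic Curves*, V.4 (Hasse invariant, `a_p ≡ 0 mod p`
  iff supersingular), Exercise 5.10–5.11.
-/

noncomputable section

namespace WeierstrassCurve

/-- NAMED FACT (existence of a good ordinary prime `≥ 5`; Serre, Publ. Math. IHÉS 54 (1981), §8:
for `E/ℚ` without CM the supersingular primes have density `0`; Deuring 1941 for CM curves:
ordinary primes are the primes split in the CM field, of density `1/2`; hence in all cases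
infinitely many good ordinary primes). For every elliptic curve over `ℚ` given by a globally
minimal Weierstrass equation `W` there is a prime `p ≥ 5` of good reduction with `p ∤ a_p(W)`
(`a_p = frobeniusTrace W p`), i.e. a good ordinary prime. Users take
`(h : WeierstrassCurve.exists_good_ordinary_prime)`. [cite: Serre1981, §8 (with Deuring 1941 for CM)] -/
def exists_good_ordinary_prime : Prop :=
  ∀ (W : WeierstrassCurve ℚ) [W.IsElliptic] [W.IsGloballyMinimal],
    ∃ (p : ℕ) (_ : Fact p.Prime), 5 ≤ p ∧ W.HasGoodReductionAtPrime p ∧ ¬ (p : ℤ) ∣ W.frobeniusTrace p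

end WeierstrassCurve

end
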